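import Summits.BirchSwinnertonDyer.BirchSwinnertonDyer.Theorems.ManinLocalTwoThreePShiftTransferBase
import HarnessLib

/-!
# The prime-generic transfer step, V: the EIGEN base bridged — `K^ε_p(N) = 0` for `p ∤ N`, `ε ≠ 1`, and at `v_p(N) = 1` for `p ≥ 5`
# (route `ManinLocalTwoThree`, cell bsd-f2-manin; cruxes C2 stmt-BirchSwinnertonDyer-22967 / C3 stmt-…-22968; LEAD seat p1 gen 12)

* `shiftEigenTrivialAtP_of_not_dvd`: p2's Serre-amalgam rigidity `shiftEigen_eq_zero` (degeneracy-conjugation form, every prime, `K = ℤ/p`,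
  eigenvalue `ζ ≠ 1`) restated in the `g0Of` vocabulary: `ShiftEigenTrivialAtP p N ζ` for `p ∤ N`, `N ≥ 1`.
* **`shiftEigenTrivialAtP_prime_mul`**: `K^ζ_p(pM) = 0` for every prime `p ≥ 5`, `M ≥ 1` prime to `p`, `ζ ≠ 1` (base + file III's transfer
  `shiftEigenTrivialAtP_mul`).
Nothing about BSD, Manin's conjecture or C2/C3 is proved here (structure theorem about `Γ₀(N)`).
[cite: DarmonDiamondTaylor1995, Lemma 4.28 (p. 135) (shape: degeneracy maps on `Γ₀`)]
-/

set_option autoImplicit false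
set_option linter.dupNamespace false

open scoped MatrixGroups

open CongruenceSubgroup Matrix.SpecialLinearGroup
  Summit.BirchSwinnertonDyer.Rank1Residual.ManinAdditive.NineShiftEqualiser

namespace Summit.BirchSwinnertonDyer.BirchSwinnertonDyer.Theorems.ManinLocalTwoThree

namespace PShiftTransfer

open ThreeShiftDescent TwoShift

variable {p : ℕ} [Fact p.Prime] {M : ℕ}

/-- **The eigen base, bridged**: p2's `shiftEigen_eq_zero` gives `K^ζ_p(N) = 0` in the `g0Of` vocabulary at every level `N ≥ 1` prime to `p`,
for every `ζ ≠ 1` in `ℤ/p`. [folklore] -/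
theorem shiftEigenTrivialAtP_of_not_dvd {N : ℕ} (hN : 0 < N) (hpN : ¬ p ∣ N) {ζ : ZMod p} (hζ : ζ ≠ 1) :
    ShiftEigenTrivialAtP p N ζ := by
  have hp : p.Prime := Fact.out
  haveI : NeZero p := ⟨hp.ne_zero⟩
  intro φ hadd hinv γ
  refine shiftEigen_eq_zero hp hN hpN ζ hζ φ hadd ?_ γ
  intro γ'
  -- entries of `γ' ∈ Γ₀(Np)`: `c = p c₀` with `N ∣ c₀`
  have hcNp : ((N * p : ℕ) : ℤ) ∣ ((γ' : SL(2, ℤ)) 1 0 : ℤ) :=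
    (ZMod.intCast_zmod_eq_zero_iff_dvd _ _).mp (Gamma0_mem.mp γ'.2)
  obtain ⟨c₀, hc₀⟩ : (p : ℤ) ∣ ((γ' : SL(2, ℤ)) 1 0 : ℤ) := dvd_trans (by push_cast; exact dvd_mul_left _ _) hcNp
  have hNc₀ : (N : ℤ) ∣ c₀ := by
    have h := hcNp
    rw [hc₀] at h
    push_cast at h
    rw [mul_comm (N : ℤ)] at h
    exact Int.dvd_of_mul_dvd_mul_left (by exact_mod_cast hp.ne_zero) h
  have hdet : ((γ' : SL(2, ℤ)) 0 0 : ℤ) * (γ' : SL(2, ℤ)) 1 1 - ((γ' : SL(2, ℤ)) 0 1 : ℤ) * (p * c₀) = 1 := by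
    rw [← hc₀]; exact gamma0_det_entries γ'
  have key := hinv ((γ' : SL(2, ℤ)) 0 0) ((γ' : SL(2, ℤ)) 0 1) c₀ ((γ' : SL(2, ℤ)) 1 1) hdet hNc₀
  have e1 : Literature.NumberTheory.EllipticCurves.ModularForms.Gamma0.degeneracyConj N (N * p) 1
      (mul_dvd_mul_left N (one_dvd p)) γ' =
      g0Of ((γ' : SL(2, ℤ)) 0 0) ((γ' : SL(2, ℤ)) 0 1) (p * c₀) ((γ' : SL(2, ℤ)) 1 1) hdet (Dvd.dvd.mul_left hNc₀ p) := by
    apply Subtype.ext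
    rw [Literature.NumberTheory.EllipticCurves.ModularForms.Gamma0.coe_degeneracyConj_one]
    ext i j
    fin_cases i <;> fin_cases j <;> simp [g0Of, slOf, hc₀]
  have e2 : Literature.NumberTheory.EllipticCurves.ModularForms.Gamma0.degeneracyConj N (N * p) p dvd_rfl γ' =
      g0Of ((γ' : SL(2, ℤ)) 0 0) (p * (γ' : SL(2, ℤ)) 0 1) c₀ ((γ' : SL(2, ℤ)) 1 1) (by linear_combination hdet) hNc₀ := by
    apply Subtype.ext
    ext i j
    fin_cases i <;> fin_cases j <;>
      simp [Literature.NumberTheory.EllipticCurves.ModularForms.Gamma0.degeneracyConj_apply, g0Of, slOf, hc₀,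
        Int.mul_ediv_cancel_left _ (show (p : ℤ) ≠ 0 by exact_mod_cast hp.ne_zero)]
  rw [e1, e2, key]

/-- **`K^ζ_p(pM) = 0` for every prime `p ≥ 5`, every `M ≥ 1` prime to `p`, every `ζ ≠ 1` in `ℤ/p`** (base + file III's transfer). [new] -/
theorem shiftEigenTrivialAtP_prime_mul (h5 : 5 ≤ p) (hM : 0 < M) (hpM : ¬ p ∣ M) {ζ : ZMod p} (hζ : ζ ≠ 1) :
    ShiftEigenTrivialAtP p (p * M) ζ :=
  shiftEigenTrivialAtP_mul (by exact_mod_cast ZMod.natCast_self p) h5 hpM ζ (shiftEigenTrivialAtP_of_not_dvd hM hpM hζ)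

end PShiftTransfer

end Summit.BirchSwinnertonDyer.BirchSwinnertonDyer.Theorems.ManinLocalTwoThree
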